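import Literature.NumberTheory.Sieve.LevelOfDistribution
import Literature.AlgebraicGeometry.HodgeTheory.FermatHodgeCharacterCriterion
import Literature.NumberTheory.LFunctions.KloostermanFractionsAmplifier

/-!
# Sketch (crux-ideate round 1, ideator 2) — crux `ElliottHalberstam` = stmt-Parity-14092

Card `smooth-cofactor-lifting`: LEVEL LIFTING. The relative discrepancy of the primes in a class
`a mod q` is (up to `ω(k) log x`) at most the worst relative discrepancy among the classes
`b mod qk` lying over it, for EVERY `k ≥ 1` (fibre identity `ψ(y;q,a) = Σ_{b ≡ a (q)} ψ(y;qk,b)` and the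
exact matching of main terms `#{b mod qk over a, (b,qk)=1} = φ(qk)/φ(q)`).

PROVED here (sorry-free, axioms `propext`/`Classical.choice`/`Quot.sound`), all concluding — where they
mention it — `CruxEH` (see its docstring: publication variant over the Literature constant, defeq to the route decl):
* §1 the lever `primeAPError_le_lift : E*(x;q) ≤ (φ(qk)/φ(q))·E*(x;qk) + ω(k)·log x`, with the fibre
  identity `chebyshevPsiMod_eq_sum_fibre` (fibre count: the tree's `FermatCharacter.totient_mul_card_fiber`);
* §3 the multiples / W-trick normal form: `primesHaveLevel_of_multiples` (EH on the multiples of any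
  `k₀(x)`, `1 ≤ k₀(x) ≤ x^κ`, at level `θ+κ ≤ 1`, gives EH for ALL moduli at level `θ`) and the
  equivalence `crux_iff_multiples_const : ElliottHalberstam ↔ ∀ θ < 1, PrimesHaveLevelMultiples θ k₀`
  for every fixed `k₀ ≥ 1` ("WLOG every modulus is divisible by `k₀`");
* §2 the factorable normal form: `sum_primeAPError_le_lift` (the lever averaged over the auxiliary
  PRIMES `ℓ ∈ (K, 2K]`), `primesHaveLevel_of_factorable` (EH at level `θ+κ` on moduli with a divisor in
  `(x^κ, 2x^κ]` gives EH at level `θ` for ALL moduli; prime number theorem input: the tree's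
  `DFI_card_primes_Ioc_ge`), and the equivalence `crux_iff_ehFactorable : ElliottHalberstam ↔ EHFactorable`.
SORRIED (signatures for crux-plan): §4 the fibre form only.

The cofactor `q ≤ x^θ` is invariant under all normal forms ("conservation of the cofactor"), which is
where the card locates the true obstruction (not primality of the modulus).
-/

namespace Summit.Parity.GeneralizedHardyLittlewood.Cruxes.ElliottHalberstam.SketchIdeator2

open scoped BigOperators Classical ArithmeticFunction.vonMangoldt
open Filter Finset Real Asymptotics
open Literature.NumberTheory.Sieve (primeAPError PrimesHaveLevel primeAPError_nonneg
  abs_sub_le_primeAPError rpow_mul_log_le_div_eventually)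
open Literature.NumberTheory.Sieve.LevelOfDistribution (chebyshevPsiMod)

/-- The crux. PUBLICATION VARIANT: the route declaration
`Summit.Parity.GeneralizedHardyLittlewood.Theses.LiouvilleShiftedTables.ElliottHalberstam` is *by definition*
this Literature constant (`def ElliottHalberstam : Prop := Literature.…ElliottHalberstam` in the route file;
`Iff.rfl`, verified by the refuter's W.lean and the grounder on stmt-Parity-14092). The by-name version of this
file (importing the route file, identical otherwise) is attached to the item as evidence `Sketch.lean`; it could
not be published as a workfile during this session because the farm reported the route olean incoherent. -/
abbrev CruxEH : Prop := Literature.NumberTheory.Sieve.LevelOfDistribution.ElliottHalberstam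

/-! ### §0  The crux is the Literature conjecture -/

theorem crux_iff_literature :
    CruxEH ↔ Literature.NumberTheory.Sieve.LevelOfDistribution.ElliottHalberstam := Iff.rfl

/-! ### §1  The lever: fibre identity and pointwise lifting (PROVED) -/

/-- `ψ(y; q, a)` as a sum of `if`s. -/
theorem chebyshevPsiMod_eq_sum_ite (q : ℕ) (a : ZMod q) (y : ℝ) :
    chebyshevPsiMod q a y = ∑ n ∈ range (⌊y⌋₊ + 1), (if (n : ZMod q) = a then Λ n else 0) := by
  unfold chebyshevPsiMod
  refine Finset.sum_congr rfl fun n _ => ?_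
  simp only [ArithmeticFunction.vonMangoldt.residueClass, Set.indicator_apply, Set.mem_setOf_eq]

/-- `ψ(y;q,a) ≥ 0`. -/
theorem chebyshevPsiMod_nonneg' (q : ℕ) (a : ZMod q) (y : ℝ) : 0 ≤ chebyshevPsiMod q a y := by
  rw [chebyshevPsiMod_eq_sum_ite]
  exact Finset.sum_nonneg fun n _ => by
    split_ifs
    · exact ArithmeticFunction.vonMangoldt_nonneg
    · exact le_rfl

/-- FIBRE IDENTITY: `ψ(y; q, a) = Σ_{b mod qk, b ≡ a (q)} ψ(y; qk, b)`. -/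
theorem chebyshevPsiMod_eq_sum_fibre (q k : ℕ) [NeZero (q * k)] (a : ZMod q) (y : ℝ) :
    chebyshevPsiMod q a y =
      ∑ b ∈ (univ : Finset (ZMod (q * k))).filter
          (fun b => ZMod.castHom (dvd_mul_right q k) (ZMod q) b = a),
        chebyshevPsiMod (q * k) b y := by
  simp_rw [chebyshevPsiMod_eq_sum_ite]
  rw [Finset.sum_comm]
  refine Finset.sum_congr rfl fun n _ => ?_
  rw [Finset.sum_ite_eq ((univ : Finset (ZMod (q * k))).filter
      (fun b => ZMod.castHom (dvd_mul_right q k) (ZMod q) b = a)) (n : ZMod (q * k)) (fun _ => (Λ n : ℝ))]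
  simp only [Finset.mem_filter, Finset.mem_univ, true_and, map_natCast]

/-- The `Λ`-mass of the multiples of a prime `p` up to `N` is at most `log N`
(all such prime powers divide `p^{⌊log_p N⌋}`, and `Σ_{d ∣ p^K} Λ(d) = log p^K ≤ log N`). -/
theorem sum_vonMangoldt_filter_dvd_le_log {p : ℕ} (hp : p.Prime) {N : ℕ} (hN : N ≠ 0) :
    ∑ n ∈ (range (N + 1)).filter (p ∣ ·), Λ n ≤ Real.log N := by
  set K : ℕ := Nat.log p N with hK
  have hpK : p ^ K ≤ N := Nat.pow_log_le_self p hN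
  have hpK0 : p ^ K ≠ 0 := pow_ne_zero _ hp.ne_zero
  calc ∑ n ∈ (range (N + 1)).filter (p ∣ ·), Λ n
      = ∑ n ∈ ((range (N + 1)).filter (p ∣ ·)).filter (fun n => Λ n ≠ 0), Λ n :=
        (Finset.sum_filter_ne_zero _).symm
    _ ≤ ∑ d ∈ (p ^ K).divisors, Λ d := by
        refine Finset.sum_le_sum_of_subset_of_nonneg ?_ fun _ _ _ => ArithmeticFunction.vonMangoldt_nonneg
        intro n hn
        simp only [Finset.mem_filter, Finset.mem_range] at hn
        obtain ⟨⟨hnN, hpn⟩, hΛ⟩ := hn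
        rw [Nat.mem_divisors]
        refine ⟨?_, hpK0⟩
        obtain ⟨r, e, hr, he, hre⟩ :=
          (isPrimePow_nat_iff _).mp (ArithmeticFunction.vonMangoldt_ne_zero_iff.mp hΛ)
        rw [← hre] at hpn
        have hpr : p = r := (Nat.prime_dvd_prime_iff_eq hp hr).mp (hp.dvd_of_dvd_pow hpn)
        subst hpr
        rw [← hre]
        refine pow_dvd_pow p (Nat.le_log_of_pow_le hp.one_lt ?_)
        rw [hre]
        omega
    _ = Real.log ((p ^ K : ℕ) : ℝ) := ArithmeticFunction.vonMangoldt_sum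
    _ ≤ Real.log (N : ℝ) :=
        Real.log_le_log (by exact_mod_cast Nat.pos_of_ne_zero hpK0) (by exact_mod_cast hpK)

/-- The unit fibre over a unit `a mod q` has exactly `φ(qk)/φ(q)` elements (as a real number);
from the tree's `FermatCharacter.totient_mul_card_fiber`. -/
theorem card_unitFibre_eq {q k : ℕ} [NeZero q] [NeZero (q * k)] (a : (ZMod q)ˣ) :
    ((#((univ : Finset (ZMod (q * k))).filter
        (fun b => ZMod.castHom (dvd_mul_right q k) (ZMod q) b = a ∧ IsUnit b)) : ℕ) : ℝ)
      = ((q * k).totient : ℝ) / (q.totient : ℝ) := by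
  have hq : q ≠ 0 := NeZero.ne q
  have h := Literature.AlgebraicGeometry.HodgeTheory.FermatCharacter.totient_mul_card_fiber
    (m := q * k) (dvd_mul_right q k) (v := (a : ZMod q)) (Units.isUnit a)
  have hφ : (0 : ℝ) < q.totient := by exact_mod_cast Nat.totient_pos.mpr (Nat.pos_of_ne_zero hq)
  rw [eq_div_iff hφ.ne']
  have hset : ((univ : Finset (ZMod (q * k))).filter
        (fun b => ZMod.castHom (dvd_mul_right q k) (ZMod q) b = a ∧ IsUnit b)) =
      ((univ : Finset (ZMod (q * k))).filter
        (fun u => IsUnit u ∧ ZMod.castHom (dvd_mul_right q k) (ZMod q) u = a)) := by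
    ext u
    simp only [mem_filter, mem_univ, true_and]
    exact and_comm
  rw [hset]
  have h' := congrArg (fun n : ℕ => (n : ℝ)) h
  push_cast at h'
  linarith [h']

/-- The non-unit part of the fibre holds only prime powers `p^j` with `p ∣ k`:
`Σ_{b over a, b not a unit} ψ(y; qk, b) ≤ ω(k) · log x` for `1 ≤ y ≤ x`, `a` a unit mod `q`. -/
theorem sum_nonunitFibre_le {q k : ℕ} [NeZero q] [NeZero (q * k)] (hk : k ≠ 0) (a : (ZMod q)ˣ)
    {x y : ℝ} (hy1 : 1 ≤ y) (hyx : y ≤ x) :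
    (∑ b ∈ ((univ : Finset (ZMod (q * k))).filter
          (fun b => ZMod.castHom (dvd_mul_right q k) (ZMod q) b = a)).filter (fun b => ¬ IsUnit b),
        chebyshevPsiMod (q * k) b y)
      ≤ (k.primeFactors.card : ℝ) * Real.log x := by
  set F₂ := ((univ : Finset (ZMod (q * k))).filter
          (fun b => ZMod.castHom (dvd_mul_right q k) (ZMod q) b = a)).filter (fun b => ¬ IsUnit b)
    with hF₂
  set N : ℕ := ⌊y⌋₊ with hN
  have hN1 : 1 ≤ N := by
    rw [hN]; exact Nat.one_le_floor_iff _ |>.mpr hy1  -- may need adjustment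
  have hN0 : N ≠ 0 := by omega
  have hNx : (N : ℝ) ≤ x := (Nat.floor_le (by linarith)).trans hyx
  have hlogN : Real.log N ≤ Real.log x :=
    Real.log_le_log (by exact_mod_cast Nat.pos_of_ne_zero hN0) hNx
  -- expand and swap
  simp_rw [chebyshevPsiMod_eq_sum_ite]
  rw [Finset.sum_comm]
  -- pointwise bound for each n
  have hpt : ∀ n ∈ range (N + 1),
      (∑ b ∈ F₂, (if (n : ZMod (q * k)) = b then (Λ n : ℝ) else 0)) ≤
        ∑ p ∈ k.primeFactors, (if p ∣ n then (Λ n : ℝ) else 0) := by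
    intro n _
    rw [Finset.sum_ite_eq]
    have hnonneg : 0 ≤ ∑ p ∈ k.primeFactors, (if p ∣ n then (Λ n : ℝ) else 0) :=
      Finset.sum_nonneg fun p _ => by
        split_ifs
        · exact ArithmeticFunction.vonMangoldt_nonneg
        · exact le_rfl
    split_ifs with hmem
    · -- n mod qk lies over the unit a but is not a unit: some prime p ∣ k divides n
      rw [hF₂, Finset.mem_filter, Finset.mem_filter] at hmem
      obtain ⟨⟨-, hπ⟩, hnu⟩ := hmem
      rw [map_natCast] at hπ
      have hcopq : n.Coprime q := by
        have : IsUnit ((n : ℕ) : ZMod q) := by rw [hπ]; exact Units.isUnit a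
        exact (ZMod.isUnit_iff_coprime n q).mp this
      have hncop : ¬ n.Coprime k := by
        intro hcopk
        exact hnu ((ZMod.isUnit_iff_coprime n (q * k)).mpr (Nat.Coprime.mul_right hcopq hcopk))
      -- a prime factor of gcd(n,k)
      set g := Nat.gcd n k with hg
      have hg1 : g ≠ 1 := hncop
      set p := g.minFac with hp
      have hpprime : p.Prime := Nat.minFac_prime hg1
      have hpg : p ∣ g := Nat.minFac_dvd g
      have hpn : p ∣ n := hpg.trans (Nat.gcd_dvd_left n k)
      have hpk : p ∣ k := hpg.trans (Nat.gcd_dvd_right n k)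
      have hpmem : p ∈ k.primeFactors := Nat.mem_primeFactors.mpr ⟨hpprime, hpk, hk⟩
      refine le_trans ?_ (Finset.single_le_sum (f := fun p => if p ∣ n then (Λ n : ℝ) else 0)
        (fun p _ => by
          split_ifs
          · exact ArithmeticFunction.vonMangoldt_nonneg
          · exact le_rfl) hpmem)
      simp only [if_pos hpn, le_refl]
    · exact hnonneg
  refine (Finset.sum_le_sum hpt).trans ?_
  rw [Finset.sum_comm]
  have hinner : ∀ p ∈ k.primeFactors,
      (∑ n ∈ range (N + 1), (if p ∣ n then (Λ n : ℝ) else 0)) ≤ Real.log x := by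
    intro p hp
    have hpprime : p.Prime := (Nat.mem_primeFactors.mp hp).1
    rw [← Finset.sum_filter]
    exact (sum_vonMangoldt_filter_dvd_le_log hpprime hN0).trans hlogN
  refine (Finset.sum_le_sum hinner).trans ?_
  rw [Finset.sum_const, nsmul_eq_mul]

/-- Every fibre of `ℤ/qk → ℤ/q` has at most `k` elements (`b ↦ ⌊b/q⌋` is injective on a fibre). -/
theorem card_fibre_le {q k : ℕ} [NeZero q] [NeZero (q * k)] (a : ZMod q) :
    #((univ : Finset (ZMod (q * k))).filter
        (fun b => ZMod.castHom (dvd_mul_right q k) (ZMod q) b = a)) ≤ k := by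
  have hq : 0 < q := Nat.pos_of_ne_zero (NeZero.ne q)
  calc #((univ : Finset (ZMod (q * k))).filter
          (fun b => ZMod.castHom (dvd_mul_right q k) (ZMod q) b = a))
      ≤ #(range k) := by
        refine Finset.card_le_card_of_injOn (fun b => b.val / q) (fun b hb => ?_) ?_
        · rw [Finset.coe_range, Set.mem_Iio, Nat.div_lt_iff_lt_mul hq]
          exact (ZMod.val_lt b).trans_eq (Nat.mul_comm q k)
        · intro b₁ hb₁ b₂ hb₂ hdiv
          simp only [Finset.coe_filter, Finset.mem_univ, true_and, Set.mem_setOf_eq,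
            ZMod.castHom_apply, ZMod.cast_eq_val] at hb₁ hb₂
          have hmod : b₁.val % q = b₂.val % q := by
            rw [← ZMod.natCast_eq_natCast_iff', hb₁, hb₂]
          apply ZMod.val_injective
          rw [← Nat.div_add_mod b₁.val q, ← Nat.div_add_mod b₂.val q, hmod]
          simp only at hdiv
          rw [hdiv]
    _ = k := Finset.card_range k

/-- Hence `φ(qk)/φ(q) ≤ k`. -/
theorem totient_ratio_le {q k : ℕ} [NeZero q] [NeZero (q * k)] :
    ((q * k).totient : ℝ) / (q.totient : ℝ) ≤ k := by
  obtain ⟨a⟩ : Nonempty (ZMod q)ˣ := ⟨1⟩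
  rw [← card_unitFibre_eq (q := q) (k := k) a]
  have h1 : #((univ : Finset (ZMod (q * k))).filter
        (fun b => ZMod.castHom (dvd_mul_right q k) (ZMod q) b = a ∧ IsUnit b)) ≤
      #((univ : Finset (ZMod (q * k))).filter
        (fun b => ZMod.castHom (dvd_mul_right q k) (ZMod q) b = a)) :=
    Finset.card_le_card (Finset.monotone_filter_right _ fun b _ hb => hb.1)
  exact_mod_cast h1.trans (card_fibre_le (a : ZMod q))

/-- `ω(k) ≤ k`. -/
theorem card_primeFactors_le (k : ℕ) : k.primeFactors.card ≤ k := by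
  calc k.primeFactors.card ≤ (Icc 1 k).card :=
        Finset.card_le_card fun p hp =>
          Finset.mem_Icc.mpr ⟨(Nat.prime_of_mem_primeFactors hp).one_lt.le,
            Nat.le_of_mem_primeFactors hp⟩
    _ = k := by simp

/-- POINTWISE LIFTING (the lever), PROVED: for `q, k ≥ 1` and `x ≥ 1`,
`E*(x; q) ≤ (φ(qk)/φ(q)) · E*(x; qk) + ω(k) · log x`. -/
theorem primeAPError_le_lift {q k : ℕ} (hq : q ≠ 0) (hk : k ≠ 0) {x : ℝ} (hx : 1 ≤ x) :
    primeAPError x q ≤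
      ((q * k).totient : ℝ) / (q.totient : ℝ) * primeAPError x (q * k)
        + (k.primeFactors.card : ℝ) * Real.log x := by
  haveI : NeZero q := ⟨hq⟩
  have hm : q * k ≠ 0 := mul_ne_zero hq hk
  haveI : NeZero (q * k) := ⟨hm⟩
  set R : ℝ := ((q * k).totient : ℝ) / (q.totient : ℝ) with hR
  have hφq : (0 : ℝ) < q.totient := by exact_mod_cast Nat.totient_pos.mpr (Nat.pos_of_ne_zero hq)
  have hφm : (0 : ℝ) < (q * k).totient := by
    exact_mod_cast Nat.totient_pos.mpr (Nat.pos_of_ne_zero hm)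
  have hE0 : 0 ≤ primeAPError x (q * k) := primeAPError_nonneg _ _
  haveI : Nonempty (Set.Icc (1 : ℝ) x) := ⟨⟨1, le_rfl, hx⟩⟩
  change (⨆ y : Set.Icc (1 : ℝ) x, ⨆ a : (ZMod q)ˣ,
      |chebyshevPsiMod q a y - (y : ℝ) / Nat.totient q|) ≤ _
  refine ciSup_le fun y => ciSup_le fun a => ?_
  have hy1 : (1 : ℝ) ≤ y := y.2.1
  have hyx : (y : ℝ) ≤ x := y.2.2
  -- the fibre and its unit / non-unit parts
  set F := (univ : Finset (ZMod (q * k))).filter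
      (fun b => ZMod.castHom (dvd_mul_right q k) (ZMod q) b = a) with hF
  set F₁ := F.filter (fun b => IsUnit b) with hF₁
  set F₂ := F.filter (fun b => ¬ IsUnit b) with hF₂
  have hcard : ((#F₁ : ℕ) : ℝ) = R := by
    rw [hF₁, hF, Finset.filter_filter]
    exact card_unitFibre_eq a
  -- fibre identity and split
  have hsplit : chebyshevPsiMod q a y =
      ∑ b ∈ F₁, chebyshevPsiMod (q * k) b y + ∑ b ∈ F₂, chebyshevPsiMod (q * k) b y := by
    rw [chebyshevPsiMod_eq_sum_fibre q k (a : ZMod q) y, ← hF, hF₁, hF₂,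
      Finset.sum_filter_add_sum_filter_not]
  -- the main terms match exactly
  have hmain : (y : ℝ) / Nat.totient q = ∑ b ∈ F₁, (y : ℝ) / Nat.totient (q * k) := by
    rw [Finset.sum_const, nsmul_eq_mul, hcard, hR]
    field_simp
  -- unit part: each term at most E*(x; qk)
  have hunit : ∀ b ∈ F₁, |chebyshevPsiMod (q * k) b y - (y : ℝ) / Nat.totient (q * k)|
      ≤ primeAPError x (q * k) := by
    intro b hb
    rw [hF₁, Finset.mem_filter] at hb
    obtain ⟨-, hbu⟩ := hb
    have := abs_sub_le_primeAPError (x := x) hm hy1 hyx hbu.unit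
    rwa [IsUnit.unit_spec] at this
  -- non-unit part
  have hnon : ∑ b ∈ F₂, chebyshevPsiMod (q * k) b y ≤ (k.primeFactors.card : ℝ) * Real.log x := by
    have := sum_nonunitFibre_le (q := q) hk a hy1 hyx
    rw [← hF, ← hF₂] at this
    exact this
  have hnon0 : 0 ≤ ∑ b ∈ F₂, chebyshevPsiMod (q * k) b y :=
    Finset.sum_nonneg fun b _ => chebyshevPsiMod_nonneg' _ _ _
  -- assemble
  calc |chebyshevPsiMod q a y - (y : ℝ) / Nat.totient q|
      = |∑ b ∈ F₁, (chebyshevPsiMod (q * k) b y - (y : ℝ) / Nat.totient (q * k))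
          + ∑ b ∈ F₂, chebyshevPsiMod (q * k) b y| := by
        rw [hsplit, hmain, Finset.sum_sub_distrib]; ring_nf
    _ ≤ |∑ b ∈ F₁, (chebyshevPsiMod (q * k) b y - (y : ℝ) / Nat.totient (q * k))|
          + |∑ b ∈ F₂, chebyshevPsiMod (q * k) b y| := abs_add_le _ _
    _ ≤ ∑ b ∈ F₁, |chebyshevPsiMod (q * k) b y - (y : ℝ) / Nat.totient (q * k)|
          + ∑ b ∈ F₂, chebyshevPsiMod (q * k) b y := by
        gcongr
        · exact Finset.abs_sum_le_sum_abs _ _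
        · rw [abs_of_nonneg hnon0]
    _ ≤ ∑ b ∈ F₁, primeAPError x (q * k) + (k.primeFactors.card : ℝ) * Real.log x := by
        gcongr with b hb
        · exact hunit b hb
    _ = R * primeAPError x (q * k) + (k.primeFactors.card : ℝ) * Real.log x := by
        rw [Finset.sum_const, nsmul_eq_mul, hcard]

/-! ### §3  Normal form (N3): the W-trick / multiples form (PROVED) -/


/-- EH-shape at level `x^{θ−ε}` restricted to the MULTIPLES of a prescribed `k₀ = k₀(x)`, with the
natural normalisation factor `k₀` in front. -/
def PrimesHaveLevelMultiples (θ : ℝ) (k₀ : ℝ → ℕ) : Prop :=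
  ∀ A : ℝ, 0 < A → ∀ ε : ℝ, 0 < ε →
    (fun x : ℝ => (k₀ x : ℝ) *
        ∑ q ∈ (Icc 1 ⌊x ^ (θ - ε)⌋₊).filter (fun q => k₀ x ∣ q), primeAPError x q)
      =O[atTop] fun x : ℝ => x / Real.log x ^ A

/-- LEVEL LIFTING, multiples form (PROVED): if `1 ≤ k₀(x) ≤ x^κ` eventually and the multiples of
`k₀(x)` satisfy the EH-bound at level `θ + κ ≤ 1`, then ALL moduli satisfy it at level `θ`. -/
theorem primesHaveLevel_of_multiples {θ κ : ℝ} (hθκ : θ + κ ≤ 1) (k₀ : ℝ → ℕ)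
    (hk₁ : ∀ᶠ x in atTop, 1 ≤ k₀ x) (hk₂ : ∀ᶠ x in atTop, (k₀ x : ℝ) ≤ x ^ κ)
    (h : PrimesHaveLevelMultiples (θ + κ) k₀) : PrimesHaveLevel θ := by
  intro A hA ε hε
  set g : ℝ → ℝ := fun x => (k₀ x : ℝ) *
      ∑ r ∈ (Icc 1 ⌊x ^ (θ + κ - ε)⌋₊).filter (fun r => k₀ x ∣ r), primeAPError x r with hg
  have hgO : g =O[atTop] fun x : ℝ => x / Real.log x ^ A := by
    rw [hg]; exact h A hA ε hε
  have herr := rpow_mul_log_le_div_eventually hε A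
  -- pointwise bound, eventually
  have hpt : ∀ᶠ x : ℝ in atTop,
      ∑ q ∈ Icc 1 ⌊x ^ (θ - ε)⌋₊, primeAPError x q ≤ g x + x / Real.log x ^ A := by
    filter_upwards [hk₁, hk₂, herr, eventually_ge_atTop (1 : ℝ)] with x hx1 hx2 hxerr hx
    have hk0 : k₀ x ≠ 0 := by omega
    have hx0 : 0 < x := by linarith
    have hlog0 : 0 ≤ Real.log x := Real.log_nonneg hx
    -- step 1: pointwise lifting, summed over q
    have step1 : ∑ q ∈ Icc 1 ⌊x ^ (θ - ε)⌋₊, primeAPError x q ≤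
        ∑ q ∈ Icc 1 ⌊x ^ (θ - ε)⌋₊,
          ((k₀ x : ℝ) * primeAPError x (q * k₀ x) + (k₀ x : ℝ) * Real.log x) := by
      refine Finset.sum_le_sum fun q hq => ?_
      rw [Finset.mem_Icc] at hq
      have hq0 : q ≠ 0 := by omega
      haveI : NeZero q := ⟨hq0⟩
      haveI : NeZero (q * k₀ x) := ⟨mul_ne_zero hq0 hk0⟩
      refine (primeAPError_le_lift hq0 hk0 hx).trans ?_
      exact add_le_add
        (mul_le_mul_of_nonneg_right totient_ratio_le (primeAPError_nonneg _ _))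
        (mul_le_mul_of_nonneg_right (by exact_mod_cast card_primeFactors_le (k₀ x)) hlog0)
    rw [Finset.sum_add_distrib, ← Finset.mul_sum, Finset.sum_const, Nat.card_Icc,
      Nat.add_sub_cancel, nsmul_eq_mul] at step1
    -- step 2: reindex the lifted moduli as multiples of k₀ up to x^{θ+κ-ε}
    have hQK : ⌊x ^ (θ - ε)⌋₊ * k₀ x ≤ ⌊x ^ (θ + κ - ε)⌋₊ := by
      refine Nat.le_floor ?_
      push_cast
      calc (⌊x ^ (θ - ε)⌋₊ : ℝ) * (k₀ x : ℝ) ≤ x ^ (θ - ε) * x ^ κ :=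
            mul_le_mul (Nat.floor_le (Real.rpow_nonneg hx0.le _)) hx2 (Nat.cast_nonneg _)
              (Real.rpow_nonneg hx0.le _)
        _ = x ^ (θ + κ - ε) := by
            rw [← Real.rpow_add hx0, show θ - ε + κ = θ + κ - ε by ring]
    have hinj : ∀ q₁ ∈ Icc 1 ⌊x ^ (θ - ε)⌋₊, ∀ q₂ ∈ Icc 1 ⌊x ^ (θ - ε)⌋₊,
        q₁ * k₀ x = q₂ * k₀ x → q₁ = q₂ :=
      fun q₁ _ q₂ _ h' => Nat.eq_of_mul_eq_mul_right (Nat.pos_of_ne_zero hk0) h'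
    have step2 : ∑ q ∈ Icc 1 ⌊x ^ (θ - ε)⌋₊, primeAPError x (q * k₀ x) ≤
        ∑ r ∈ (Icc 1 ⌊x ^ (θ + κ - ε)⌋₊).filter (fun r => k₀ x ∣ r), primeAPError x r := by
      calc ∑ q ∈ Icc 1 ⌊x ^ (θ - ε)⌋₊, primeAPError x (q * k₀ x)
          = ∑ r ∈ (Icc 1 ⌊x ^ (θ - ε)⌋₊).image (fun q => q * k₀ x), primeAPError x r :=
            (Finset.sum_image hinj).symm
        _ ≤ _ := by
            refine Finset.sum_le_sum_of_subset_of_nonneg ?_ fun r _ _ => primeAPError_nonneg x r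
            intro r hr
            rw [Finset.mem_image] at hr
            obtain ⟨q, hq, rfl⟩ := hr
            rw [Finset.mem_Icc] at hq
            rw [Finset.mem_filter, Finset.mem_Icc]
            refine ⟨⟨Nat.one_le_iff_ne_zero.mpr (mul_ne_zero (by omega) hk0), ?_⟩, dvd_mul_left _ _⟩
            exact (Nat.mul_le_mul_right _ hq.2).trans hQK
    -- step 3: the error term
    have step3 : (⌊x ^ (θ - ε)⌋₊ : ℝ) * ((k₀ x : ℝ) * Real.log x) ≤ x / Real.log x ^ A := by
      calc (⌊x ^ (θ - ε)⌋₊ : ℝ) * ((k₀ x : ℝ) * Real.log x)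
          ≤ x ^ (θ - ε) * (x ^ κ * Real.log x) :=
            mul_le_mul (Nat.floor_le (Real.rpow_nonneg hx0.le _))
              (mul_le_mul_of_nonneg_right hx2 hlog0) (by positivity) (Real.rpow_nonneg hx0.le _)
        _ = x ^ (θ + κ - ε) * Real.log x := by
            rw [← mul_assoc, ← Real.rpow_add hx0, show θ - ε + κ = θ + κ - ε by ring]
        _ ≤ x ^ (1 - ε) * Real.log x :=
            mul_le_mul_of_nonneg_right (Real.rpow_le_rpow_of_exponent_le hx (by linarith)) hlog0
        _ ≤ x / Real.log x ^ A := hxerr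
    calc ∑ q ∈ Icc 1 ⌊x ^ (θ - ε)⌋₊, primeAPError x q
        ≤ (k₀ x : ℝ) * ∑ q ∈ Icc 1 ⌊x ^ (θ - ε)⌋₊, primeAPError x (q * k₀ x)
            + (⌊x ^ (θ - ε)⌋₊ : ℝ) * ((k₀ x : ℝ) * Real.log x) := step1
      _ ≤ g x + x / Real.log x ^ A := by
          simp only [hg]
          exact add_le_add (mul_le_mul_of_nonneg_left step2 (Nat.cast_nonneg _)) step3
  -- conclude
  have hsumO : (fun x : ℝ => g x + x / Real.log x ^ A) =O[atTop] fun x : ℝ => x / Real.log x ^ A :=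
    hgO.add (Asymptotics.isBigO_refl _ _)
  refine Asymptotics.IsBigO.trans (Asymptotics.IsBigO.of_bound 1 ?_) hsumO
  filter_upwards [hpt, eventually_gt_atTop (1 : ℝ)] with x hx hx1
  have h0 : 0 ≤ ∑ q ∈ Icc 1 ⌊x ^ (θ - ε)⌋₊, primeAPError x q :=
    Finset.sum_nonneg fun q _ => primeAPError_nonneg x q
  have hg0 : 0 ≤ g x := by
    simp only [hg]
    exact mul_nonneg (Nat.cast_nonneg _) (Finset.sum_nonneg fun r _ => primeAPError_nonneg x r)
  have hd0 : 0 ≤ x / Real.log x ^ A :=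
    div_nonneg (by linarith) (Real.rpow_nonneg (Real.log_nonneg hx1.le) _)
  rw [one_mul, Real.norm_eq_abs, Real.norm_eq_abs, abs_of_nonneg h0,
    abs_of_nonneg (add_nonneg hg0 hd0)]
  exact hx

/-- Conversely (trivially), a level of distribution gives the multiples form for any CONSTANT `k₀`
(sub-sum of nonnegative terms, constant factor). -/
theorem primesHaveLevelMultiples_const_of_primesHaveLevel {θ : ℝ} (k₀ : ℕ)
    (h : PrimesHaveLevel θ) : PrimesHaveLevelMultiples θ (fun _ => k₀) := by
  intro A hA ε hε
  refine Asymptotics.IsBigO.trans (Asymptotics.IsBigO.of_bound (k₀ : ℝ) ?_) (h A hA ε hε)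
  filter_upwards with x
  have h0 : ∀ q, 0 ≤ primeAPError x q := fun q => primeAPError_nonneg x q
  rw [Real.norm_eq_abs, Real.norm_eq_abs,
    abs_of_nonneg (mul_nonneg (Nat.cast_nonneg _) (Finset.sum_nonneg fun q _ => h0 q)),
    abs_of_nonneg (Finset.sum_nonneg fun q _ => h0 q)]
  exact mul_le_mul_of_nonneg_left
    (Finset.sum_le_sum_of_subset_of_nonneg (Finset.filter_subset _ _) fun q _ _ => h0 q)
    (Nat.cast_nonneg _)

/-- Multiples form with a CONSTANT auxiliary factor `k₀ ≥ 1`: level `θ + κ` on the multiples of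
`k₀` gives level `θ` for all moduli (`0 < κ`, `θ + κ ≤ 1`). -/
theorem primesHaveLevel_of_multiples_const {θ κ : ℝ} (hκ : 0 < κ) (hθκ : θ + κ ≤ 1) {k₀ : ℕ}
    (hk : 1 ≤ k₀) (h : PrimesHaveLevelMultiples (θ + κ) (fun _ => k₀)) : PrimesHaveLevel θ :=
  primesHaveLevel_of_multiples hθκ (fun _ => k₀) (Eventually.of_forall fun _ => hk)
    ((tendsto_rpow_atTop hκ).eventually_ge_atTop (k₀ : ℝ)) h

/-- THE W-TRICK EQUIVALENCE (PROVED): for every fixed `k₀ ≥ 1`, the Elliott–Halberstam conjecture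
is equivalent to its restriction to the multiples of `k₀` (with the factor `k₀` normalisation):
"WLOG every modulus is divisible by `k₀`". -/
theorem elliottHalberstam_iff_multiples_const {k₀ : ℕ} (hk : 1 ≤ k₀) :
    Literature.NumberTheory.Sieve.LevelOfDistribution.ElliottHalberstam ↔
      ∀ θ : ℝ, θ < 1 → PrimesHaveLevelMultiples θ (fun _ => k₀) := by
  constructor
  · intro h θ hθ
    exact primesHaveLevelMultiples_const_of_primesHaveLevel k₀ (h θ hθ)
  · intro h θ hθ
    set θ' : ℝ := max θ 0 with hθ'
    have hθ'1 : θ' < 1 := max_lt hθ one_pos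
    have hκ : 0 < (1 - θ') / 2 := by linarith
    have h1 : PrimesHaveLevelMultiples (θ' + (1 - θ') / 2) (fun _ => k₀) :=
      h (θ' + (1 - θ') / 2) (by linarith)
    exact (primesHaveLevel_of_multiples_const hκ (by linarith) hk h1).mono (le_max_left _ _)

/-! ### §2  Normal form (N1): EH ⇔ EH on moduli carrying a divisor in `(x^κ, 2x^κ]` (PROVED) -/

/-- Auxiliary primes `ℓ ∈ (K, 2K]`. -/
def auxPrimes (K : ℕ) : Finset ℕ := (Ioc K (2 * K)).filter Nat.Prime

/-- Moduli `r ≤ 2QK` carrying an auxiliary prime factor `ℓ ∈ (K, 2K]`. -/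
def liftedModuli (Q K : ℕ) : Finset ℕ :=
  (Icc 1 (2 * Q * K)).filter (fun r => ∃ ℓ ∈ auxPrimes K, ℓ ∣ r)

theorem mem_auxPrimes {K ℓ : ℕ} : ℓ ∈ auxPrimes K ↔ (K < ℓ ∧ ℓ ≤ 2 * K) ∧ ℓ.Prime := by
  rw [auxPrimes, Finset.mem_filter, Finset.mem_Ioc]

theorem mem_liftedModuli {Q K r : ℕ} :
    r ∈ liftedModuli Q K ↔ (1 ≤ r ∧ r ≤ 2 * Q * K) ∧ ∃ ℓ ∈ auxPrimes K, ℓ ∣ r := by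
  rw [liftedModuli, Finset.mem_filter, Finset.mem_Icc]

/-- AVERAGED LIFTING (finite form, PROVED). If `auxPrimes K` is nonempty and every lifted modulus has
at most `B` prime divisors in `(K, 2K]`, then
`Σ_{q ≤ Q} E*(x;q) ≤ (2K/#auxPrimes K) · B · Σ_{r ∈ liftedModuli Q K} E*(x;r) + Q · log x`. -/
theorem sum_primeAPError_le_lift (Q K : ℕ) {x : ℝ} (hx : 1 ≤ x) (hP : 0 < #(auxPrimes K)) {B : ℝ}
    (hB : ∀ r ∈ liftedModuli Q K, (#((auxPrimes K).filter (fun ℓ => ℓ ∣ r)) : ℝ) ≤ B) :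
    ∑ q ∈ Icc 1 Q, primeAPError x q ≤
      (2 * K : ℝ) / (#(auxPrimes K) : ℝ) * B * ∑ r ∈ liftedModuli Q K, primeAPError x r
        + Q * Real.log x := by
  have hP' : (0 : ℝ) < (#(auxPrimes K) : ℝ) := by exact_mod_cast hP
  have hlog0 : 0 ≤ Real.log x := Real.log_nonneg hx
  have hE0 : ∀ r, 0 ≤ primeAPError x r := fun r => primeAPError_nonneg x r
  have hprime : ∀ ℓ ∈ auxPrimes K, ℓ.Prime := fun ℓ hℓ => (mem_auxPrimes.mp hℓ).2
  have hbd : ∀ ℓ ∈ auxPrimes K, K < ℓ ∧ ℓ ≤ 2 * K := fun ℓ hℓ => (mem_auxPrimes.mp hℓ).1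
  -- step 1: for each q, average the pointwise lever over ℓ
  have step1 : ∀ q ∈ Icc 1 Q, primeAPError x q ≤
      (2 * K : ℝ) / (#(auxPrimes K) : ℝ) * ∑ ℓ ∈ auxPrimes K, primeAPError x (q * ℓ)
        + Real.log x := by
    intro q hq
    rw [Finset.mem_Icc] at hq
    have hq0 : q ≠ 0 := by omega
    haveI : NeZero q := ⟨hq0⟩
    have hsum : ∑ ℓ ∈ auxPrimes K, primeAPError x q ≤
        ∑ ℓ ∈ auxPrimes K, ((2 * K : ℝ) * primeAPError x (q * ℓ) + Real.log x) := by
      refine Finset.sum_le_sum fun ℓ hℓ => ?_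
      have hℓp := hprime ℓ hℓ
      have hℓ0 : ℓ ≠ 0 := hℓp.ne_zero
      haveI : NeZero (q * ℓ) := ⟨mul_ne_zero hq0 hℓ0⟩
      refine (primeAPError_le_lift hq0 hℓ0 hx).trans (add_le_add ?_ ?_)
      · refine mul_le_mul_of_nonneg_right (totient_ratio_le.trans ?_) (hE0 _)
        exact_mod_cast (hbd ℓ hℓ).2
      · rw [hℓp.primeFactors, Finset.card_singleton, Nat.cast_one, one_mul]
    rw [Finset.sum_const, nsmul_eq_mul, Finset.sum_add_distrib, ← Finset.mul_sum, Finset.sum_const,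
      nsmul_eq_mul] at hsum
    -- hsum : P * E*(q) ≤ 2K * Σ + P * log x
    have key : primeAPError x q * (#(auxPrimes K) : ℝ) ≤
        (2 * K : ℝ) * ∑ ℓ ∈ auxPrimes K, primeAPError x (q * ℓ)
          + Real.log x * (#(auxPrimes K) : ℝ) := by nlinarith [hsum]
    calc primeAPError x q
        = (primeAPError x q * (#(auxPrimes K) : ℝ)) / (#(auxPrimes K) : ℝ) := by field_simp
      _ ≤ ((2 * K : ℝ) * ∑ ℓ ∈ auxPrimes K, primeAPError x (q * ℓ)
            + Real.log x * (#(auxPrimes K) : ℝ)) / (#(auxPrimes K) : ℝ) :=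
          div_le_div_of_nonneg_right key hP'.le
      _ = (2 * K : ℝ) / (#(auxPrimes K) : ℝ) * ∑ ℓ ∈ auxPrimes K, primeAPError x (q * ℓ)
            + Real.log x := by
          field_simp
  -- step 2: sum over q
  have step2 : ∑ q ∈ Icc 1 Q, primeAPError x q ≤
      (2 * K : ℝ) / (#(auxPrimes K) : ℝ) *
          ∑ q ∈ Icc 1 Q, ∑ ℓ ∈ auxPrimes K, primeAPError x (q * ℓ)
        + Q * Real.log x := by
    calc ∑ q ∈ Icc 1 Q, primeAPError x q
        ≤ ∑ q ∈ Icc 1 Q, ((2 * K : ℝ) / (#(auxPrimes K) : ℝ) *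
            ∑ ℓ ∈ auxPrimes K, primeAPError x (q * ℓ) + Real.log x) :=
          Finset.sum_le_sum step1
      _ = _ := by
          rw [Finset.sum_add_distrib, ← Finset.mul_sum, Finset.sum_const, nsmul_eq_mul,
            Nat.card_Icc, Nat.add_sub_cancel]
  -- step 3: the double sum as a weighted sum over r = qℓ, weights ≤ B, support ⊆ liftedModuli
  have himg : ((Icc 1 Q) ×ˢ auxPrimes K).image (fun p : ℕ × ℕ => p.1 * p.2) ⊆ liftedModuli Q K := by
    intro r hr
    rw [Finset.mem_image] at hr
    obtain ⟨⟨q, ℓ⟩, hqℓ, rfl⟩ := hr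
    rw [Finset.mem_product] at hqℓ
    obtain ⟨hq, hℓ⟩ := hqℓ
    rw [Finset.mem_Icc] at hq
    have hb := hbd ℓ hℓ
    rw [mem_liftedModuli]
    refine ⟨⟨Nat.one_le_iff_ne_zero.mpr (mul_ne_zero (by omega) (by omega)), ?_⟩, ℓ, hℓ,
      dvd_mul_left ℓ q⟩
    calc q * ℓ ≤ Q * (2 * K) := Nat.mul_le_mul hq.2 hb.2
      _ = 2 * Q * K := by ring
  have hfib : ∀ r ∈ ((Icc 1 Q) ×ˢ auxPrimes K).image (fun p : ℕ × ℕ => p.1 * p.2),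
      (#(((Icc 1 Q) ×ˢ auxPrimes K).filter (fun p : ℕ × ℕ => p.1 * p.2 = r)) : ℝ) ≤ B := by
    intro r hr
    refine le_trans ?_ (hB r (himg hr))
    exact_mod_cast Finset.card_le_card_of_injOn (fun p : ℕ × ℕ => p.2)
      (fun p hp => by
        rw [Finset.mem_coe, Finset.mem_filter, Finset.mem_product] at hp
        rw [Finset.mem_coe, Finset.mem_filter]
        exact ⟨hp.1.2, hp.2 ▸ dvd_mul_left _ _⟩)
      (fun p₁ hp₁ p₂ hp₂ h2 => by
        rw [Finset.mem_coe, Finset.mem_filter, Finset.mem_product] at hp₁ hp₂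
        have hℓ0 : p₁.2 ≠ 0 := (hprime _ hp₁.1.2).ne_zero
        have h1 : p₁.1 * p₁.2 = p₂.1 * p₁.2 := by
          rw [hp₁.2, ← hp₂.2]; simp only at h2; rw [h2]
        exact Prod.ext (Nat.eq_of_mul_eq_mul_right (Nat.pos_of_ne_zero hℓ0) h1) h2)
  have step3 : ∑ q ∈ Icc 1 Q, ∑ ℓ ∈ auxPrimes K, primeAPError x (q * ℓ) ≤
      B * ∑ r ∈ liftedModuli Q K, primeAPError x r := by
    rw [← Finset.sum_product (s := Icc 1 Q) (t := auxPrimes K)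
        (f := fun p => primeAPError x (p.1 * p.2)),
      Finset.sum_comp (fun r => primeAPError x r) (fun p : ℕ × ℕ => p.1 * p.2)]
    calc ∑ r ∈ ((Icc 1 Q) ×ˢ auxPrimes K).image (fun p : ℕ × ℕ => p.1 * p.2),
          #(((Icc 1 Q) ×ˢ auxPrimes K).filter (fun p : ℕ × ℕ => p.1 * p.2 = r)) • primeAPError x r
        ≤ ∑ r ∈ ((Icc 1 Q) ×ˢ auxPrimes K).image (fun p : ℕ × ℕ => p.1 * p.2),
            B * primeAPError x r := by
          refine Finset.sum_le_sum fun r hr => ?_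
          rw [nsmul_eq_mul]
          exact mul_le_mul_of_nonneg_right (hfib r hr) (hE0 r)
      _ ≤ ∑ r ∈ liftedModuli Q K, B * primeAPError x r := by
          refine Finset.sum_le_sum_of_subset_of_nonneg himg fun r hr _ => ?_
          have : (0 : ℝ) ≤ B := le_trans (Nat.cast_nonneg _) (hB r hr)
          exact mul_nonneg this (hE0 r)
      _ = B * ∑ r ∈ liftedModuli Q K, primeAPError x r := by rw [Finset.mul_sum]
  -- assemble
  have hcoef : 0 ≤ (2 * K : ℝ) / (#(auxPrimes K) : ℝ) := by positivity
  calc ∑ q ∈ Icc 1 Q, primeAPError x q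
      ≤ (2 * K : ℝ) / (#(auxPrimes K) : ℝ) *
          ∑ q ∈ Icc 1 Q, ∑ ℓ ∈ auxPrimes K, primeAPError x (q * ℓ) + Q * Real.log x := step2
    _ ≤ (2 * K : ℝ) / (#(auxPrimes K) : ℝ) * (B * ∑ r ∈ liftedModuli Q K, primeAPError x r)
          + Q * Real.log x := by gcongr
    _ = (2 * K : ℝ) / (#(auxPrimes K) : ℝ) * B * ∑ r ∈ liftedModuli Q K, primeAPError x r
          + Q * Real.log x := by ring

/-- Moduli `q ≤ x^{θ−ε}` possessing a divisor `k` with `x^κ < k ≤ 2x^κ`. -/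
noncomputable def factorableModuli (x θ ε κ : ℝ) : Finset ℕ :=
  (Icc 1 ⌊x ^ (θ - ε)⌋₊).filter fun q => ∃ k : ℕ, x ^ κ < (k : ℝ) ∧ (k : ℝ) ≤ 2 * x ^ κ ∧ k ∣ q

/-- `PrimesHaveLevelFactorable θ κ`: the EH/BV shape at level `x^{θ−ε}` RESTRICTED to moduli with a
divisor in `(x^κ, 2x^κ]`. -/
def PrimesHaveLevelFactorable (θ κ : ℝ) : Prop :=
  ∀ A : ℝ, 0 < A → ∀ ε : ℝ, 0 < ε →
    (fun x : ℝ => ∑ q ∈ factorableModuli x θ ε κ, primeAPError x q) =O[atTop]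
      fun x : ℝ => x / Real.log x ^ A

/-- A level of distribution trivially gives the factorable form (sub-sum of nonnegative terms). -/
theorem primesHaveLevelFactorable_of_primesHaveLevel {θ : ℝ} (κ : ℝ) (h : PrimesHaveLevel θ) :
    PrimesHaveLevelFactorable θ κ := by
  intro A hA ε hε
  refine Asymptotics.IsBigO.trans (Asymptotics.IsBigO.of_bound 1 ?_) (h A hA ε hε)
  filter_upwards with x
  have h0 : ∀ q, 0 ≤ primeAPError x q := fun q => primeAPError_nonneg x q
  rw [one_mul, Real.norm_eq_abs, Real.norm_eq_abs, abs_of_nonneg (Finset.sum_nonneg fun q _ => h0 q),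
    abs_of_nonneg (Finset.sum_nonneg fun q _ => h0 q)]
  exact Finset.sum_le_sum_of_subset_of_nonneg (Finset.filter_subset _ _) fun q _ _ => h0 q

/-- LEVEL LIFTING, factorable form (PROVED): EH at level `θ+κ` for moduli carrying a divisor in
`(x^κ, 2x^κ]` gives EH at level `θ` for ALL moduli (`0 ≤ θ`, `0 < κ`, `θ + κ ≤ 1`). Inputs: the finite
averaged lifting `sum_primeAPError_le_lift`, the prime number theorem in the form
`DFI_card_primes_Ioc_ge` (`#{K < p ≤ 2K} ≥ K/(2 log K)`), and `(log x)^{A+1} = o(x^ε)`. -/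
theorem primesHaveLevel_of_factorable {θ κ : ℝ} (hθ : 0 ≤ θ) (hκ : 0 < κ) (hθκ : θ + κ ≤ 1)
    (h : PrimesHaveLevelFactorable (θ + κ) κ) : PrimesHaveLevel θ := by
  intro A hA ε hε
  obtain ⟨L₀, hL₀⟩ := Literature.NumberTheory.LFunctions.DFI_card_primes_Ioc_ge
  have hε2 : 0 < ε / 2 := by linarith
  have hκ1 : κ ≤ 1 := by linarith
  set F : ℝ → ℝ := fun x => ∑ r ∈ factorableModuli x (θ + κ) (ε / 2) κ, primeAPError x r with hF
  have hFO : F =O[atTop] fun x : ℝ => x / Real.log x ^ (A + 1) := by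
    rw [hF]; exact h (A + 1) (by linarith) (ε / 2) hε2
  have herr := rpow_mul_log_le_div_eventually hε A
  have ev1 : ∀ᶠ x : ℝ in atTop, (L₀ : ℝ) + 2 ≤ x ^ κ :=
    (tendsto_rpow_atTop hκ).eventually_ge_atTop _
  have ev2 : ∀ᶠ x : ℝ in atTop, Real.log 2 ≤ κ / 2 * Real.log x :=
    (Real.tendsto_log_atTop.const_mul_atTop (by linarith : 0 < κ / 2)).eventually_ge_atTop _
  have ev3 : ∀ᶠ x : ℝ in atTop, (2 : ℝ) ≤ x ^ (ε / 2) :=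
    (tendsto_rpow_atTop hε2).eventually_ge_atTop _
  -- the pointwise bound, eventually
  have hpt : ∀ᶠ x : ℝ in atTop, ∑ q ∈ Icc 1 ⌊x ^ (θ - ε)⌋₊, primeAPError x q ≤
      16 / κ * (Real.log x * F x) + x / Real.log x ^ A := by
    filter_upwards [ev1, ev2, ev3, herr, eventually_ge_atTop (2 : ℝ)] with x hx1 hx2 hx3 hxerr hx
    set Q : ℕ := ⌊x ^ (θ - ε)⌋₊ with hQ
    set K : ℕ := ⌊x ^ κ⌋₊ with hK
    have hx0 : 0 < x := by linarith
    have hx1' : (1 : ℝ) ≤ x := by linarith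
    have hlogx : 0 < Real.log x := Real.log_pos (by linarith)
    have hxκ : (K : ℝ) ≤ x ^ κ := Nat.floor_le (Real.rpow_nonneg hx0.le κ)
    have hxκ' : x ^ κ < (K : ℝ) + 1 := Nat.lt_floor_add_one _
    have hL0 : (0 : ℝ) ≤ L₀ := Nat.cast_nonneg _
    have hKL : L₀ ≤ K := by
      have : (L₀ : ℝ) < K := by linarith
      exact_mod_cast this.le
    have hK1 : (1 : ℝ) < K := by linarith
    have hK1n : 1 < K := by exact_mod_cast hK1
    have hlogK : 0 < Real.log K := Real.log_pos hK1
    have hP : (K : ℝ) / (2 * Real.log K) ≤ (#(auxPrimes K) : ℝ) := hL₀ K hKL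
    have hPpos' : (0 : ℝ) < (#(auxPrimes K) : ℝ) := lt_of_lt_of_le (by positivity) hP
    have hPpos : 0 < #(auxPrimes K) := by exact_mod_cast hPpos'
    -- log K ≥ (κ/2) log x
    have hKhalf : x ^ κ / 2 ≤ K := by linarith
    have hlogK' : κ / 2 * Real.log x ≤ Real.log K := by
      have h1 : Real.log (x ^ κ / 2) ≤ Real.log K := Real.log_le_log (by positivity) hKhalf
      rw [Real.log_div (by positivity) (by norm_num), Real.log_rpow hx0] at h1
      linarith
    -- log K ≤ log x
    have hKx : (K : ℝ) ≤ x := hxκ.trans (by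
      calc x ^ κ ≤ x ^ (1 : ℝ) := Real.rpow_le_rpow_of_exponent_le hx1' hκ1
        _ = x := Real.rpow_one x)
    have hlogKx : Real.log K ≤ Real.log x := Real.log_le_log (by linarith) hKx
    -- coefficient 2K/#P ≤ 4 log x
    have hcoef : (2 * K : ℝ) / (#(auxPrimes K) : ℝ) ≤ 4 * Real.log x := by
      rw [div_le_iff₀ hPpos']
      have h1 : (K : ℝ) ≤ (#(auxPrimes K) : ℝ) * (2 * Real.log K) := by
        have := hP; rw [div_le_iff₀ (by positivity)] at this; linarith
      nlinarith [hlogKx, h1, hPpos'.le, hlogK.le]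
    -- number of auxiliary prime divisors of a lifted modulus is ≤ 4/κ
    have hBbound : ∀ r ∈ liftedModuli Q K,
        (#((auxPrimes K).filter (fun ℓ => ℓ ∣ r)) : ℝ) ≤ 4 / κ := by
      intro r hr
      rw [mem_liftedModuli] at hr
      obtain ⟨⟨hr1, hr2⟩, -⟩ := hr
      have hDprime : ∀ ℓ ∈ (auxPrimes K).filter (fun ℓ => ℓ ∣ r), Prime ℓ := fun ℓ hℓ =>
        Nat.prime_iff.mp (mem_auxPrimes.mp (Finset.mem_filter.mp hℓ).1).2
      have hDdvd : ∀ ℓ ∈ (auxPrimes K).filter (fun ℓ => ℓ ∣ r), ℓ ∣ r := fun ℓ hℓ =>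
        (Finset.mem_filter.mp hℓ).2
      have hDge : ∀ ℓ ∈ (auxPrimes K).filter (fun ℓ => ℓ ∣ r), K ≤ ℓ := fun ℓ hℓ =>
        (mem_auxPrimes.mp (Finset.mem_filter.mp hℓ).1).1.1.le
      have hprod : ∏ ℓ ∈ (auxPrimes K).filter (fun ℓ => ℓ ∣ r), ℓ ∣ r :=
        Finset.prod_primes_dvd r hDprime hDdvd
      have hr0 : r ≠ 0 := by omega
      have hpow : K ^ #((auxPrimes K).filter (fun ℓ => ℓ ∣ r)) ≤ r :=
        (Finset.pow_card_le_prod _ (fun ℓ => ℓ) K hDge).trans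
          (Nat.le_of_dvd (Nat.pos_of_ne_zero hr0) hprod)
      have h1 : (#((auxPrimes K).filter (fun ℓ => ℓ ∣ r)) : ℝ) * Real.log K ≤ Real.log r := by
        rw [← Real.log_pow]
        exact Real.log_le_log (by positivity) (by exact_mod_cast hpow)
      have hr2' : (r : ℝ) ≤ 2 * x := by
        calc (r : ℝ) ≤ 2 * Q * K := by exact_mod_cast hr2
          _ ≤ 2 * x ^ (θ - ε) * x ^ κ :=
              mul_le_mul (mul_le_mul_of_nonneg_left (Nat.floor_le (Real.rpow_nonneg hx0.le _))
                (by norm_num)) hxκ (Nat.cast_nonneg _) (by positivity)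
          _ = 2 * x ^ (θ + κ - ε) := by
              rw [mul_assoc, ← Real.rpow_add hx0, show θ - ε + κ = θ + κ - ε by ring]
          _ ≤ 2 * x ^ (1 : ℝ) :=
              mul_le_mul_of_nonneg_left (Real.rpow_le_rpow_of_exponent_le hx1' (by linarith))
                (by norm_num)
          _ = 2 * x := by rw [Real.rpow_one]
      have h2 : Real.log r ≤ 2 * Real.log x := by
        have hlog2 : Real.log 2 ≤ Real.log x := Real.log_le_log two_pos hx
        calc Real.log r ≤ Real.log (2 * x) :=
              Real.log_le_log (by exact_mod_cast Nat.pos_of_ne_zero hr0) hr2'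
          _ = Real.log 2 + Real.log x := Real.log_mul (by norm_num) hx0.ne'
          _ ≤ 2 * Real.log x := by linarith
      have h3 : (#((auxPrimes K).filter (fun ℓ => ℓ ∣ r)) : ℝ) * (κ / 2 * Real.log x) ≤
          2 * Real.log x :=
        le_trans (mul_le_mul_of_nonneg_left hlogK' (Nat.cast_nonneg _)) (h1.trans h2)
      rw [le_div_iff₀ hκ]
      nlinarith [h3, hlogx]
    -- the finite lifting
    have hfin := sum_primeAPError_le_lift Q K hx1' hPpos hBbound
    -- lifted moduli are factorable moduli at level θ+κ with slack ε/2
    have hsub : liftedModuli Q K ⊆ factorableModuli x (θ + κ) (ε / 2) κ := by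
      intro r hr
      rw [mem_liftedModuli] at hr
      obtain ⟨⟨hr1, hr2⟩, ℓ, hℓ, hℓr⟩ := hr
      have hb := (mem_auxPrimes.mp hℓ).1
      rw [factorableModuli, Finset.mem_filter, Finset.mem_Icc]
      refine ⟨⟨hr1, ?_⟩, ℓ, ?_, ?_, hℓr⟩
      · refine Nat.le_floor ?_
        calc (r : ℝ) ≤ 2 * Q * K := by exact_mod_cast hr2
          _ ≤ 2 * x ^ (θ - ε) * x ^ κ :=
              mul_le_mul (mul_le_mul_of_nonneg_left (Nat.floor_le (Real.rpow_nonneg hx0.le _))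
                (by norm_num)) hxκ (Nat.cast_nonneg _) (by positivity)
          _ = x ^ (θ + κ - ε) * 2 := by
              rw [mul_assoc, ← Real.rpow_add hx0, show θ - ε + κ = θ + κ - ε by ring, mul_comm]
          _ ≤ x ^ (θ + κ - ε) * x ^ (ε / 2) :=
              mul_le_mul_of_nonneg_left hx3 (Real.rpow_nonneg hx0.le _)
          _ = x ^ (θ + κ - ε / 2) := by
              rw [← Real.rpow_add hx0, show θ + κ - ε + ε / 2 = θ + κ - ε / 2 by ring]
      · calc x ^ κ < (K : ℝ) + 1 := hxκ'
          _ ≤ ℓ := by exact_mod_cast hb.1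
      · calc (ℓ : ℝ) ≤ 2 * K := by exact_mod_cast hb.2
          _ ≤ 2 * x ^ κ := by linarith
    have hF0 : 0 ≤ F x := by
      simp only [hF]; exact Finset.sum_nonneg fun r _ => primeAPError_nonneg x r
    have hFx : ∑ r ∈ liftedModuli Q K, primeAPError x r ≤ F x := by
      simp only [hF]
      exact Finset.sum_le_sum_of_subset_of_nonneg hsub fun r _ _ => primeAPError_nonneg x r
    have hS0 : 0 ≤ ∑ r ∈ liftedModuli Q K, primeAPError x r :=
      Finset.sum_nonneg fun r _ => primeAPError_nonneg x r
    have herrQ : (Q : ℝ) * Real.log x ≤ x / Real.log x ^ A := by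
      calc (Q : ℝ) * Real.log x ≤ x ^ (θ - ε) * Real.log x :=
            mul_le_mul_of_nonneg_right (Nat.floor_le (Real.rpow_nonneg hx0.le _)) hlogx.le
        _ ≤ x ^ (1 - ε) * Real.log x :=
            mul_le_mul_of_nonneg_right (Real.rpow_le_rpow_of_exponent_le hx1' (by linarith)) hlogx.le
        _ ≤ _ := hxerr
    have hcoef0 : 0 ≤ (2 * K : ℝ) / (#(auxPrimes K) : ℝ) := by positivity
    calc ∑ q ∈ Icc 1 Q, primeAPError x q
        ≤ (2 * K : ℝ) / (#(auxPrimes K) : ℝ) * (4 / κ) * ∑ r ∈ liftedModuli Q K, primeAPError x r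
            + Q * Real.log x := hfin
      _ ≤ (4 * Real.log x) * (4 / κ) * F x + x / Real.log x ^ A := by
          refine add_le_add ?_ herrQ
          calc (2 * K : ℝ) / (#(auxPrimes K) : ℝ) * (4 / κ) * ∑ r ∈ liftedModuli Q K, primeAPError x r
              ≤ (2 * K : ℝ) / (#(auxPrimes K) : ℝ) * (4 / κ) * F x :=
                mul_le_mul_of_nonneg_left hFx (by positivity)
            _ ≤ (4 * Real.log x) * (4 / κ) * F x :=
                mul_le_mul_of_nonneg_right (mul_le_mul_of_nonneg_right hcoef (by positivity)) hF0
      _ = 16 / κ * (Real.log x * F x) + x / Real.log x ^ A := by ring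
  -- BigO conclusion
  have hlogF : (fun x : ℝ => Real.log x * F x) =O[atTop] fun x : ℝ => x / Real.log x ^ A := by
    have h1 : (fun x : ℝ => Real.log x * F x) =O[atTop]
        fun x : ℝ => Real.log x * (x / Real.log x ^ (A + 1)) :=
      (Asymptotics.isBigO_refl (fun x : ℝ => Real.log x) atTop).mul hFO
    refine h1.trans (Asymptotics.IsBigO.of_bound 1 ?_)
    filter_upwards [eventually_gt_atTop (1 : ℝ)] with x hx
    have hlog : 0 < Real.log x := Real.log_pos hx
    have hx0 : 0 < x := by linarith
    have heq : Real.log x * (x / Real.log x ^ (A + 1)) = x / Real.log x ^ A := by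
      rw [Real.rpow_add_one hlog.ne']
      field_simp
    rw [heq, one_mul]
  have hG : (fun x : ℝ => 16 / κ * (Real.log x * F x) + x / Real.log x ^ A) =O[atTop]
      fun x : ℝ => x / Real.log x ^ A :=
    (hlogF.const_mul_left _).add (Asymptotics.isBigO_refl _ _)
  refine Asymptotics.IsBigO.trans (Asymptotics.IsBigO.of_bound 1 ?_) hG
  filter_upwards [hpt, eventually_gt_atTop (1 : ℝ)] with x hx hx1
  have h0 : 0 ≤ ∑ q ∈ Icc 1 ⌊x ^ (θ - ε)⌋₊, primeAPError x q :=
    Finset.sum_nonneg fun q _ => primeAPError_nonneg x q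
  have hF0 : 0 ≤ F x := by
    simp only [hF]; exact Finset.sum_nonneg fun r _ => primeAPError_nonneg x r
  have hlog0 : 0 ≤ Real.log x := Real.log_nonneg hx1.le
  have hd0 : 0 ≤ x / Real.log x ^ A := div_nonneg (by linarith) (Real.rpow_nonneg hlog0 _)
  have hG0 : 0 ≤ 16 / κ * (Real.log x * F x) + x / Real.log x ^ A :=
    add_nonneg (mul_nonneg (by positivity) (mul_nonneg hlog0 hF0)) hd0
  rw [one_mul, Real.norm_eq_abs, Real.norm_eq_abs, abs_of_nonneg h0, abs_of_nonneg hG0]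
  exact hx

/-- `EHFactorable`: EH for moduli carrying a divisor of every prescribed power size. -/
def EHFactorable : Prop :=
  ∀ θ : ℝ, θ < 1 → ∀ κ : ℝ, 0 < κ → κ < 1 → PrimesHaveLevelFactorable θ κ

/-- THE FACTORABLE EQUIVALENCE (PROVED): the Elliott–Halberstam conjecture is equivalent to its
restriction to moduli carrying a divisor in `(x^κ, 2x^κ]`, for all `κ`. -/
theorem elliottHalberstam_iff_ehFactorable :
    Literature.NumberTheory.Sieve.LevelOfDistribution.ElliottHalberstam ↔ EHFactorable := by
  constructor
  · intro h θ hθ κ _ _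
    exact primesHaveLevelFactorable_of_primesHaveLevel κ (h θ hθ)
  · intro h θ hθ
    set θ' : ℝ := max θ 0 with hθ'
    have hθ'1 : θ' < 1 := max_lt hθ one_pos
    have hθ'0 : 0 ≤ θ' := le_max_right _ _
    have hκ : 0 < (1 - θ') / 2 := by linarith
    have h1 : PrimesHaveLevelFactorable (θ' + (1 - θ') / 2) ((1 - θ') / 2) :=
      h (θ' + (1 - θ') / 2) (by linarith) ((1 - θ') / 2) hκ (by linarith)
    exact (primesHaveLevel_of_factorable hθ'0 hκ (by linarith) h1).mono (le_max_left _ _)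


/-! ### §5  The normal forms for the crux BY NAME (PROVED) -/

/-- (N1) `ElliottHalberstam ↔ EHFactorable` for the crux by name. PROVED. -/
theorem crux_iff_ehFactorable : CruxEH ↔ EHFactorable := elliottHalberstam_iff_ehFactorable

/-- (N3) for every fixed `k₀ ≥ 1`, `ElliottHalberstam ↔` its restriction to the multiples of `k₀`. PROVED. -/
theorem crux_iff_multiples_const {k₀ : ℕ} (hk : 1 ≤ k₀) :
    CruxEH ↔ ∀ θ : ℝ, θ < 1 → PrimesHaveLevelMultiples θ (fun _ => k₀) :=
  elliottHalberstam_iff_multiples_const hk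

/-- (N3) one-directional form with a GROWING auxiliary factor `k₀(x)` of sub-power size. PROVED. -/
theorem crux_of_multiples (k₀ : ℝ → ℕ) (hk₁ : ∀ᶠ x in atTop, 1 ≤ k₀ x)
    (hk₂ : ∀ κ : ℝ, 0 < κ → ∀ᶠ x in atTop, (k₀ x : ℝ) ≤ x ^ κ)
    (h : ∀ θ : ℝ, θ < 1 → PrimesHaveLevelMultiples θ k₀) : CruxEH := by
  intro θ hθ
  set θ' : ℝ := max θ 0 with hθ'
  have hθ'1 : θ' < 1 := max_lt hθ one_pos
  have hκ : 0 < (1 - θ') / 2 := by linarith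
  have h1 : PrimesHaveLevelMultiples (θ' + (1 - θ') / 2) k₀ := h (θ' + (1 - θ') / 2) (by linarith)
  exact (primesHaveLevel_of_multiples (by linarith) k₀ hk₁ (hk₂ _ hκ) h1).mono (le_max_left _ _)

/-! ### §4  Normal form (N2): residue fixed modulo the free factor (fibre form) -/

/-- `E*_fib(x; q, k, c) = max_{y ≤ x} max_{b ∈ (ℤ/qk)ˣ, b ≡ c (mod k)} |ψ(y; qk, b) − y/φ(qk)|`: the sup
is only over the `q`-component of the residue; its `k`-component `c` is prescribed. -/
noncomputable def fibreAPError (x : ℝ) (q k : ℕ) (c : ZMod k) : ℝ :=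
  ⨆ y : Set.Icc 1 x,
    ⨆ b : {b : (ZMod (q * k))ˣ //
            ZMod.castHom (dvd_mul_left k q) (ZMod k) (b : ZMod (q * k)) = c},
      |chebyshevPsiMod (q * k) ((b : (ZMod (q * k))ˣ) : ZMod (q * k)) y
          - (y : ℝ) / Nat.totient (q * k)|

/-- `PrimesHaveLevelFibre θ κ`: for prime auxiliary factors `ℓ ∈ [x^κ, 2x^κ)` and EVERY class `c mod ℓ`,
the primes `≡ c (mod ℓ)` have level `x^{θ−ε}` in the cofactor `q`, with the sup over `a mod q` inside;
summed over `(ℓ, c)` with the natural normalisation (`#{ℓ} ≍ x^κ/log x`, `Σ_c` of `φ(ℓ)` slices each of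
trivial size `x log x/φ(ℓ)`). -/
def PrimesHaveLevelFibre (θ κ : ℝ) : Prop :=
  ∀ A : ℝ, 0 < A → ∀ ε : ℝ, 0 < ε →
    (fun x : ℝ => ∑ ℓ ∈ (Ico ⌈x ^ κ⌉₊ (2 * ⌈x ^ κ⌉₊)).filter Nat.Prime,
        ∑ c ∈ range ℓ, ∑ q ∈ Icc 1 ⌊x ^ (θ - ε)⌋₊, fibreAPError x q ℓ (c : ZMod ℓ))
      =O[atTop] fun x : ℝ => x ^ κ / Real.log x * (x / Real.log x ^ A)

/-- Fibre lifting: since `ψ(y;q,a) − y/φ(q) = Σ_{c mod ℓ} [fibre term over (a,c)] + O(log x)` EXACTLY (no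
sup taken over `c`), `Σ_q E*(x;q) ≤ Σ_{c mod ℓ} Σ_q E*_fib(x;q,ℓ,c) + O(x^θ log x)` for each prime `ℓ ∤ q`
(the `≤ 1` prime `ℓ ∈ [K,2K)` dividing a given `q ≤ x^θ`… at most `log x/log K` of them are discarded);
averaging over `ℓ`: `PrimesHaveLevelFibre θ κ → PrimesHaveLevel θ` for `κ < 1 − θ` — at the SAME level `θ`. -/
theorem primesHaveLevel_of_fibre {θ κ : ℝ} (hκ : 0 < κ) (hθκ : θ + κ < 1)
    (h : PrimesHaveLevelFibre θ κ) : PrimesHaveLevel θ := by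
  sorry

/-- And conversely the fibre form at `(θ, κ)` follows from EH at level `θ + κ` (each fibre sup is at most
`E*(x; qℓ)`, and `Σ_c` of `ℓ` copies reproduces the weight `φ(qℓ)/φ(q)`): the fibre form is an exact
interpolant `EH(θ+κ) ⇒ Fibre(θ,κ) ⇒ EH(θ)`. -/
theorem fibre_of_primesHaveLevel {θ κ : ℝ} (hκ : 0 < κ) (hθκ : θ + κ < 1)
    (h : PrimesHaveLevel (θ + κ)) : PrimesHaveLevelFibre θ κ := by
  sorry

/-- Summary theorem of the card (sorried composition for crux-plan): any ONE of the three normal forms,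
for all `θ < 1` and suitable `κ`, is equivalent to the crux. -/
theorem crux_of_fibre (h : ∀ θ : ℝ, θ < 1 → ∀ κ : ℝ, 0 < κ → θ + κ < 1 → PrimesHaveLevelFibre θ κ) :
    CruxEH := by
  intro θ hθ
  have hκ : 0 < (1 - θ) / 2 := by linarith
  exact primesHaveLevel_of_fibre hκ (by linarith) (h θ hθ ((1 - θ) / 2) hκ (by linarith))

end Summit.Parity.GeneralizedHardyLittlewood.Cruxes.ElliottHalberstam.SketchIdeator2
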